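import Summits.NavierStokesRegularity.NavierStokesRegularity.Theorems.SelfMixingDichotomyMixingPayoffAdvectionDiffusionUnique
import Literature.Analysis.FluidPDE.RapidDecayLemmas
import HarnessLib

/-!
# Crux `SelfMixingDichotomy.CoherentScaleExclusion` (stmt-NavierStokesRegularity-1423),
# line `registered`: stub MAXP `stub_mixClass_abs_le_of_datum` — two-sided maximum principle
# in the MIX class

Support file (`--supports stmt-NavierStokesRegularity-1423`) of the line lead c3. The route's MIX
functional quantifies over "admissible" passive scalars on a window `[a, b]`: jointly `C^∞` on the
closed slab (`IsSmoothSpaceTimeOn (Icc a b) θ`), with uniform rapid decay of all within-slab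
derivatives (`HasUniformRapidDecayOn (Icc a b) θ`), solving `∂ₜθ + ⟪u, ∇θ⟫ = Δθ` with the one-sided
time derivative `timeDerivWithin (Icc a b)`. For a BOUNDED drift `‖u‖ ≤ B` such a scalar obeys the
two-sided bound `|θ(t, x)| ≤ M₀` as soon as `|θ(a, ·)| ≤ M₀`.

Proof: the tree's weak maximum principle for the Cauchy problem in the class of bounded solutions
(`MixingPayoffBirth.nonpos_of_linear_parabolic`, Friedman 1964, Ch. 2 §4 Thm. 10, bounded case) is
applied to `θ − M₀` and to `−θ − M₀` with drift `β = −u` and potential `γ = 0`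
(`mixMaxPrinciple_le_of_datum_le`). The hypotheses are supplied by the admissibility data:
continuity on the slab and `C²` slices from `IsSmoothSpaceTimeOn`, boundedness from the order-zero
decay bound `HasUniformRapidDecayOn.norm_le_rpow`, and on `(a, b]` the left time derivative (the
within-`Icc a b` derivative restricted to `Iic t`, `Icc_mem_nhdsLE_of_mem`) equals
`Δθ − ⟪u, ∇θ⟫ = Δθ + Dθ[−u]` (`inner_gradient_left`).
-/

noncomputable section

open Set Function Filter
open _root_.Topology
open scoped Laplacian

-- `Summit = Problem` for this summit; the tree lakefile sets `weak.linter.dupNamespace = false`.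
set_option linter.dupNamespace false

namespace Summit.NavierStokesRegularity.NavierStokesRegularity.Theorems

open Literature.Analysis.FluidPDE
open SelfMixingDichotomy.MixingPayoffBirth (nonpos_of_linear_parabolic)

variable {E : Type*} [NormedAddCommGroup E] [InnerProductSpace ℝ E] [FiniteDimensional ℝ E]

/-- **One-sided maximum principle with bounded drift, bounded solutions.** Let `‖β‖ ≤ B` on
`[s, T'] × E` and let `w` be bounded, continuous on `[s, T'] × E`, with `C²` slices on `(s, T']`
and, on `(s, T'] × E`, a left time derivative equal to `Δw + Dw[β]`. If `w(s, ·) ≤ M` then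
`w ≤ M` on `[s, T'] × E`: `nonpos_of_linear_parabolic` (Friedman 1964, Ch. 2 §4 Thm. 10, bounded
case) applied to `w − M` with `γ = 0`. -/
theorem mixMaxPrinciple_le_of_datum_le {β : ℝ → E → E} {w : ℝ → E → ℝ} {s T' B C M : ℝ}
    (hβ : ∀ t ∈ Icc s T', ∀ x, ‖β t x‖ ≤ B)
    (hc : ContinuousOn (uncurry w) (Icc s T' ×ˢ univ))
    (h2 : ∀ t ∈ Ioc s T', ContDiff ℝ 2 (w t))
    (ht : ∀ t ∈ Ioc s T', ∀ x, HasDerivWithinAt (fun τ => w τ x)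
      ((Δ (w t)) x + fderiv ℝ (w t) x (β t x)) (Iic t) t)
    (hbd : ∀ t ∈ Icc s T', ∀ x, |w t x| ≤ C) (h0 : ∀ x, w s x ≤ M) :
    ∀ t ∈ Icc s T', ∀ x, w t x ≤ M := by
  -- the shifted function and the zero potential
  set v : ℝ → E → ℝ := fun t x => w t x - M with hv
  set γ : ℝ → E → ℝ := fun _ _ => 0 with hγdef
  have hγ : ∀ t ∈ Icc s T', ∀ x : E, γ t x ≤ 0 := fun _ _ _ => by simp [hγdef]
  have hvc : ContinuousOn (uncurry v) (Icc s T' ×ˢ univ) := hc.sub continuousOn_const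
  have hv2 : ∀ t ∈ Ioc s T', ContDiff ℝ 2 (v t) := fun t htI => (h2 t htI).sub contDiff_const
  have hvt : ∀ t ∈ Ioc s T', ∀ x, HasDerivWithinAt (fun τ => v τ x)
      ((Δ (v t)) x + fderiv ℝ (v t) x (β t x) + γ t x * v t x) (Iic t) t := by
    intro t htI x
    have h := (ht t htI x).sub_const M
    refine h.congr_deriv ?_
    have hc1 : ContDiffAt ℝ 2 (w t) x := (h2 t htI).contDiffAt
    have hc2 : ContDiffAt ℝ 2 (fun _ : E => M) x := contDiffAt_const
    rw [show v t = w t - fun _ => M from rfl, hc1.laplacian_sub hc2,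
      fderiv_sub (hc1.differentiableAt (by norm_num)) (hc2.differentiableAt (by norm_num))]
    simp [hγdef]
  have hvb : ∀ t ∈ Icc s T', ∀ x, |v t x| ≤ C + |M| := fun t ht' x => by
    simp only [hv]
    exact (abs_sub _ _).trans (add_le_add (hbd t ht' x) le_rfl)
  have hv0 : ∀ x, v s x ≤ 0 := fun x => by
    simp only [hv]
    linarith [h0 x]
  have hz := nonpos_of_linear_parabolic hβ hγ hvc hv2 hvt hvb hv0
  intro t htI x
  have := hz t htI x
  simp only [hv] at this
  linarith

/-- **MAXP — two-sided maximum principle in the MIX class** (registered sub-goal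
`stub_mixClass_abs_le_of_datum` of the crux `CoherentScaleExclusion`, line `registered`, lead c3). A
jointly smooth, uniformly rapidly decaying solution of `∂ₜθ + ⟪u, ∇θ⟫ = Δθ` on `[a, b] × ℝ³`
(one-sided time derivative within `Icc a b`) with bounded drift `‖u‖ ≤ B` and datum `|θ(a, ·)| ≤ M₀`
satisfies `|θ| ≤ M₀` on the slab: `mixMaxPrinciple_le_of_datum_le` (the tree's bounded-class weak
maximum principle `nonpos_of_linear_parabolic`, Friedman 1964, Ch. 2 §4 Thm. 10) applied to `θ` and
to `−θ` with drift `β = −u`. -/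
theorem stub_mixClass_abs_le_of_datum :
    ∀ (a b : ℝ), a < b →
      ∀ (u : ℝ → EuclideanSpace ℝ (Fin 3) → EuclideanSpace ℝ (Fin 3))
        (θ : ℝ → EuclideanSpace ℝ (Fin 3) → ℝ) (B M₀ : ℝ),
      IsSmoothSpaceTimeOn (Set.Icc a b) θ → HasUniformRapidDecayOn (Set.Icc a b) θ →
      (∀ t ∈ Set.Icc a b, ∀ x : EuclideanSpace ℝ (Fin 3),
        timeDerivWithin (Set.Icc a b) θ t x + inner ℝ (u t x) (gradient (θ t) x) =
          Laplacian.laplacian (θ t) x) →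
      (∀ t ∈ Set.Icc a b, ∀ x : EuclideanSpace ℝ (Fin 3), ‖u t x‖ ≤ B) →
      (∀ x : EuclideanSpace ℝ (Fin 3), |θ a x| ≤ M₀) →
      ∀ t ∈ Set.Icc a b, ∀ x : EuclideanSpace ℝ (Fin 3), |θ t x| ≤ M₀ := by
  intro a b _hab u θ B M₀ hs hd he hu h0
  -- the drift `β = -u`
  set β : ℝ → EuclideanSpace ℝ (Fin 3) → EuclideanSpace ℝ (Fin 3) := fun t x => -(u t x) with hβdef
  have hβ : ∀ t ∈ Icc a b, ∀ x : EuclideanSpace ℝ (Fin 3), ‖β t x‖ ≤ B := fun t ht x => by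
    simp only [hβdef, norm_neg]
    exact hu t ht x
  -- continuity on the closed slab
  have hc : ContinuousOn (uncurry θ) (Icc a b ×ˢ univ) := hs.continuousOn
  -- `C²` slices
  have h2' : ∀ t ∈ Icc a b, ContDiff ℝ 2 (θ t) := fun t ht =>
    (hs.contDiff_slice ht).of_le (by norm_cast)
  have h2 : ∀ t ∈ Ioc a b, ContDiff ℝ 2 (θ t) := fun t ht => h2' t (Ioc_subset_Icc_self ht)
  -- the equation for the left time derivative on `(a, b]`
  have ht : ∀ t ∈ Ioc a b, ∀ x, HasDerivWithinAt (fun τ => θ τ x)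
      ((Δ (θ t)) x + fderiv ℝ (θ t) x (β t x)) (Iic t) t := by
    intro t htI x
    have htc : t ∈ Icc a b := Ioc_subset_Icc_self htI
    have heq : derivWithin (fun s => θ s x) (Icc a b) t =
        (Δ (θ t)) x - inner ℝ (u t x) (gradient (θ t) x) := eq_sub_of_add_eq (he t htc x)
    have h₁ : HasDerivWithinAt (fun s => θ s x)
        ((Δ (θ t)) x - inner ℝ (u t x) (gradient (θ t) x)) (Icc a b) t :=
      heq ▸ (hs.differentiableWithinAt_time htc x).hasDerivWithinAt
    have h := h₁.mono_of_mem_nhdsWithin (Icc_mem_nhdsLE_of_mem htI)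
    refine h.congr_deriv ?_
    rw [real_inner_comm, inner_gradient_left]
    simp only [hβdef, map_neg]
    ring
  -- boundedness from the order-zero decay bound
  obtain ⟨C, -, hC⟩ := hd.norm_le_rpow 0
  have hbd : ∀ t ∈ Icc a b, ∀ x, |θ t x| ≤ C := fun t ht' x => by
    have h1 := hC t ht' x
    simp only [Nat.cast_zero, neg_zero, Real.rpow_zero, mul_one, Real.norm_eq_abs] at h1
    exact h1
  -- the same data for `-θ`
  set θ' : ℝ → EuclideanSpace ℝ (Fin 3) → ℝ := fun t x => -θ t x with hθ'
  have hc' : ContinuousOn (uncurry θ') (Icc a b ×ˢ univ) := hc.neg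
  have h2n : ∀ t ∈ Ioc a b, ContDiff ℝ 2 (θ' t) := fun t htI => (h2 t htI).neg
  have htn : ∀ t ∈ Ioc a b, ∀ x, HasDerivWithinAt (fun τ => θ' τ x)
      ((Δ (θ' t)) x + fderiv ℝ (θ' t) x (β t x)) (Iic t) t := by
    intro t htI x
    have h := (ht t htI x).neg
    refine h.congr_deriv ?_
    rw [show θ' t = -(θ t) from rfl, InnerProductSpace.laplacian_neg, fderiv_neg]
    simp only [Pi.neg_apply, _root_.neg_apply]
    ring
  have hbdn : ∀ t ∈ Icc a b, ∀ x, |θ' t x| ≤ C := fun t ht' x => by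
    simp only [hθ', abs_neg]
    exact hbd t ht' x
  -- the two one-sided bounds
  have h0p : ∀ x, θ a x ≤ M₀ := fun x => (abs_le.1 (h0 x)).2
  have h0n : ∀ x, θ' a x ≤ M₀ := fun x => by
    simp only [hθ']
    linarith [(abs_le.1 (h0 x)).1]
  have hup := mixMaxPrinciple_le_of_datum_le hβ hc h2 ht hbd h0p
  have hdown := mixMaxPrinciple_le_of_datum_le hβ hc' h2n htn hbdn h0n
  intro t htI x
  have h₁ := hup t htI x
  have h₂ := hdown t htI x
  simp only [hθ'] at h₂
  exact abs_le.2 ⟨by linarith, h₁⟩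

end Summit.NavierStokesRegularity.NavierStokesRegularity.Theorems

end
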